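import Summits.ABC.StewartYu.ArchG3RecEnd
import Summits.ABC.StewartYu.RecordExitsCapped
import HarnessLib

/-!
# The archimedean record of reference `ArchG3Rec` — exit B on the capped letters (instantiation of `exitB_capped`)

Support file (elementary theorems; no named facts). Cell `abc-stewartyu`, route `YuMatveevShapeRat`, crux r2 `ArchCoreRat`
(stmt-ABC-20502, plan R41: p1 owns the capped exits); seat p1. The END degree scale `ρ = K·N·L/2^Ŝ ∈ [2, L/2^{n+23})`
(`D j = ⌊ρ/A j⌋ + 1`), the SHARP range `2^{n+23}·X < 2X_fin + 1` (`n ≥ 2`), `D₀ ≤ XL/2`, and the box-to-weights charge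
**`L ≤ c_L(n,K)·Ω`** with `c_L = 24C_bⁿK·yload_K/G + 2^{n+25} + 4K + 4·3ⁿ + 4n + 110` (from `L`'s definition: balanced main
term `≤ 24C_bⁿΩK·yload_K/G` as `W ≤ WN`, floors, `A_max ≤ Ω`, `Ŝ ≤ ŜK + N`, `N ≤ (2/log 2)ⁿΩ ≤ 3ⁿΩ`, `Ω ≥ 1`); then
`exitB` = `RecordExitsNumeric.exitB_capped` at these letters, with the two numeric side conditions `hN0/hN1` on `c_L`
left as hypotheses (their discharge for all `n ≥ 2` — factorials and `K = ⌈n·e^{8(n+1)+2}⌉+1` against `2^{n²+…}` — is the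
sequel `ArchG3RecEndNum`). NO `hcorner`.

## References
* [Nesterenko2003] Yu. V. Nesterenko, LNM 1819 (2003) — §5.2 Lemma 5.4, (5.5)–(5.6), (5.12), (5.17)–(5.18).
-/

noncomputable section

open Finset Real

namespace Summit.ABC.StewartYu

namespace ArchG3Rec

open PadicG3Par (cG cM Cb cG_pos Cb_pos)
open ArchG3Par (G K SdK yloadK G_eq eight_le_G G_pos one_le_K K_pos two_G_le_yloadK yloadK_pos)

variable {n : ℕ} (P : ArchG3Rec n)

/-! ### The END degree scale `ρ = KNL/2^Ŝ` -/

/-- `ρ := K·N·L/2^Ŝ`: `D j ≤ ρ/A j + 1`, `2 ≤ ρ`, `ρ < L/2^{n+23}`. [cite: Nesterenko2003, §5.2 (5.5)–(5.6)] -/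
theorem rho_facts : (∀ j, (P.D j : ℝ) ≤ (K n : ℝ) * P.N * P.L / 2 ^ P.Sd / P.A j + 1) ∧
    (2 : ℝ) ≤ (K n : ℝ) * P.N * P.L / 2 ^ P.Sd ∧ (K n : ℝ) * P.N * P.L / 2 ^ P.Sd < (P.L : ℝ) / 2 ^ (n + 23) := by
  obtain ⟨hlo, hhi⟩ := P.Sd_sandwich
  have hlo' : (2 : ℝ) ^ (n + 23) * ((K n : ℝ) * P.N) < (2 : ℝ) ^ P.Sd := by exact_mod_cast hlo
  have hhi' : (2 : ℝ) ^ P.Sd ≤ (2 : ℝ) ^ (n + 24) * ((K n : ℝ) * P.N) := by exact_mod_cast hhi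
  have hKN : (0 : ℝ) < (K n : ℝ) * P.N := by have := K_pos n; have := P.N_facts.1; positivity
  obtain ⟨-, hL0, h25, -⟩ := P.L_real
  refine ⟨fun j => ?_, ?_, ?_⟩
  · obtain ⟨hA0, -, -⟩ := P.A_facts j
    unfold D; push_cast
    have e : (K n : ℝ) * P.N * P.L / (2 ^ P.Sd * P.A j) = (K n : ℝ) * P.N * P.L / 2 ^ P.Sd / P.A j := by
      rw [div_div]
    have h := Nat.floor_le (show 0 ≤ (K n : ℝ) * P.N * P.L / (2 ^ P.Sd * P.A j) by positivity)
    rw [← e]; linarith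
  · -- `2^Ŝ ≤ 2^{n+24}KN` and `L ≥ 2^{n+25}`
    rw [le_div_iff₀ (by positivity)]
    calc (2 : ℝ) * 2 ^ P.Sd ≤ 2 * (2 ^ (n + 24) * ((K n : ℝ) * P.N)) := by linarith
      _ = ((K n : ℝ) * P.N) * 2 ^ (n + 25) := by rw [pow_succ]; ring
      _ ≤ ((K n : ℝ) * P.N) * P.L := mul_le_mul_of_nonneg_left h25 hKN.le
      _ = (K n : ℝ) * P.N * P.L := by ring
  · rw [div_lt_div_iff₀ (by positivity) (by positivity)]
    calc (K n : ℝ) * P.N * P.L * 2 ^ (n + 23) = (2 ^ (n + 23) * ((K n : ℝ) * P.N)) * P.L := by ring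
      _ < 2 ^ P.Sd * P.L := mul_lt_mul_of_pos_right hlo' hL0
      _ = P.L * 2 ^ P.Sd := mul_comm _ _

/-- **the SHARP END range** (`n ≥ 2`): `2^{n+23}·X < 2X_fin + 1` (`(n+1)(2X_fin+1) ≥ 2^{2n+23}X − n + 1` and
`2ⁿ ≥ n + 2`). [cite: Nesterenko2003, §5.2 (5.12)] -/
theorem Xfin_sharp (hn2 : 2 ≤ n) : (2 : ℝ) ^ (n + 23) * P.X < 2 * (P.Xfin : ℝ) + 1 := by
  have hXs := P.Xs_Sd_ge
  have hX128 := P.X_floors.2.1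
  have hn1 : (0 : ℝ) < (n : ℝ) + 1 := by positivity
  have hdiv := Nat.lt_div_mul_add (a := 2 ^ n * P.Xs P.Sd) (b := n + 1) (by omega)
  have h1 : ((2 ^ n * P.Xs P.Sd : ℕ) : ℝ) < ((2 ^ n * P.Xs P.Sd / (n + 1) * (n + 1) + (n + 1) : ℕ) : ℝ) := by
    exact_mod_cast hdiv
  have eX : ((2 ^ n * P.Xs P.Sd / (n + 1) : ℕ) : ℝ) = (P.Xfin : ℝ) := by unfold Xfin; rfl
  push_cast at h1
  rw [eX] at h1
  -- `2^{2n+23} X ≤ 2^{n+1} Xs Ŝ < 2 (Xfin + 1)(n+1)`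
  have h2 : (2 : ℝ) ^ (2 * n + 23) * P.X ≤ 2 ^ (n + 1) * (P.Xs P.Sd : ℝ) := by
    rw [show 2 * n + 23 = (n + 1) + (n + 22) by ring, pow_add, mul_assoc]
    exact mul_le_mul_of_nonneg_left hXs (by positivity)
  -- `2ⁿ ≥ n + 2` for `n ≥ 2`
  have hpow : (n : ℝ) + 2 ≤ (2 : ℝ) ^ n := by
    obtain ⟨m, rfl⟩ : ∃ m, n = m + 2 := ⟨n - 2, by omega⟩
    have h : m + 1 ≤ 2 ^ m := Nat.succ_le_of_lt Nat.lt_two_pow_self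
    have h2 : m + 2 + 2 ≤ 2 ^ (m + 2) := by
      rw [pow_succ, pow_succ]; omega
    exact_mod_cast h2
  -- `(n+1)·2^{n+23}·X + (n+1) ≤ 2^{2n+23}·X` since `2^{2n+23}X − (n+1)2^{n+23}X = 2^{n+23}X(2ⁿ − n − 1) ≥ 2^{n+23}X ≥ n+1`
  have e2 : (2 : ℝ) ^ (2 * n + 23) = 2 ^ n * 2 ^ (n + 23) := by rw [← pow_add]; ring_nf
  have h223 : (1 : ℝ) ≤ 2 ^ (n + 23) := one_le_pow₀ (by norm_num)
  have hn0 : (0 : ℝ) ≤ n := Nat.cast_nonneg n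
  have h3 : ((n : ℝ) + 1) * (2 ^ (n + 23) * P.X) + ((n : ℝ) + 1) ≤ 2 ^ (2 * n + 23) * P.X := by
    rw [e2]
    have hX0 : (0 : ℝ) ≤ 2 ^ (n + 23) * P.X := by positivity
    have hY : (n : ℝ) + 1 ≤ 2 ^ (n + 23) * P.X := by
      have h := Nat.lt_two_pow_self (n := n)
      have h' : (n : ℝ) < (2 : ℝ) ^ n := by exact_mod_cast h
      have h'' : (2 : ℝ) ^ n ≤ 2 ^ (n + 23) := pow_le_pow_right₀ (by norm_num) (by omega)
      nlinarith
    have h4 := mul_le_mul_of_nonneg_right hpow hX0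
    calc ((n : ℝ) + 1) * (2 ^ (n + 23) * P.X) + ((n : ℝ) + 1)
        ≤ ((n : ℝ) + 1) * (2 ^ (n + 23) * P.X) + 2 ^ (n + 23) * P.X := by linarith
      _ = ((n : ℝ) + 2) * (2 ^ (n + 23) * P.X) := by ring
      _ ≤ 2 ^ n * (2 ^ (n + 23) * P.X) := h4
      _ = 2 ^ n * 2 ^ (n + 23) * P.X := by ring
  -- combine: `(n+1)(2^{n+23}X) + (n+1) ≤ 2^{n+1}Xs < 2(Xfin+1)(n+1)`
  have h4 : ((n : ℝ) + 1) * (2 ^ (n + 23) * P.X) + ((n : ℝ) + 1) < 2 * (((P.Xfin : ℝ) + 1) * ((n : ℝ) + 1)) := by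
    have : (2 : ℝ) ^ (n + 1) * (P.Xs P.Sd : ℝ) = 2 * (2 ^ n * (P.Xs P.Sd : ℝ)) := by rw [pow_succ]; ring
    nlinarith
  have h5 : ((n : ℝ) + 1) * (2 ^ (n + 23) * P.X) < ((n : ℝ) + 1) * (2 * (P.Xfin : ℝ) + 1) := by nlinarith
  exact lt_of_mul_lt_mul_left h5 hn1.le

/-- **the box scale charged to the weights**: `L ≤ c_L·Ω` with
`c_L = 24C_bⁿK·yload_K/G + 2^{n+25} + 4K + 4·3ⁿ + 4n + 110`. [folklore] -/
theorem L_le_mul_Omega : (P.L : ℝ) ≤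
    (24 * Cb ^ n * K n * yloadK n / G n + 2 ^ (n + 25) + 4 * K n + 4 * 3 ^ n + 4 * n + 110) * P.Ω := by
  obtain ⟨hΩ0, hΩ1, hAΩ, -⟩ := P.Ω_facts
  obtain ⟨hN0, hN1, -⟩ := P.N_facts
  obtain ⟨-, hWWN, -, hWN0⟩ := P.WN_bounds
  have hG := G_pos n
  have hK := K_pos n
  have hK1 : (1 : ℝ) ≤ K n := by exact_mod_cast one_le_K n
  have hy := yloadK_pos n
  have hCb : (0 : ℝ) < Cb ^ n := pow_pos Cb_pos n
  have hW := P.hW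
  -- `L ≤ ⌈main⌉ + 2^{n+25} + ⌈2Amax/N⌉ + 1 + 4(Ŝ+2)` in `ℕ`, then real bounds
  have hLnat : P.L ≤ ⌈24 * Cb ^ n * P.Ω * K n * yloadK n * P.W / (G n * P.WN)⌉₊ + 2 ^ (n + 25) +
      (⌈2 * P.Amax / P.N⌉₊ + 1) + 4 * (P.Sd + 2) := by
    unfold L
    refine max_le (max_le ?_ ?_) (max_le ?_ ?_)
    · exact le_trans (le_trans (Nat.le_add_right _ _) (Nat.le_add_right _ _)) (Nat.le_add_right _ _)
    · exact le_trans (le_trans (Nat.le_add_left _ _) (Nat.le_add_right _ _)) (Nat.le_add_right _ _)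
    · exact le_trans (Nat.le_add_left _ _) (Nat.le_add_right _ _)
    · exact Nat.le_add_left _ _
  have hmain0 : 0 ≤ 24 * Cb ^ n * P.Ω * K n * yloadK n * P.W / (G n * P.WN) := by positivity
  have hmain : (⌈24 * Cb ^ n * P.Ω * K n * yloadK n * P.W / (G n * P.WN)⌉₊ : ℝ) ≤
      24 * Cb ^ n * K n * yloadK n / G n * P.Ω + 1 := by
    have h1 := (Nat.ceil_lt_add_one hmain0).le
    have h2 : 24 * Cb ^ n * P.Ω * K n * yloadK n * P.W / (G n * P.WN) ≤ 24 * Cb ^ n * K n * yloadK n / G n * P.Ω := by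
      rw [div_le_iff₀ (by positivity)]
      have : P.W ≤ P.WN := hWWN
      have h0 : 0 ≤ 24 * Cb ^ n * P.Ω * K n * yloadK n := by positivity
      calc 24 * Cb ^ n * P.Ω * K n * yloadK n * P.W ≤ 24 * Cb ^ n * P.Ω * K n * yloadK n * P.WN :=
            mul_le_mul_of_nonneg_left this h0
        _ = 24 * Cb ^ n * K n * yloadK n / G n * P.Ω * (G n * P.WN) := by field_simp
    linarith
  have hA : (⌈2 * P.Amax / P.N⌉₊ : ℝ) ≤ 2 * P.Ω + 1 := by
    have h0 : 0 ≤ 2 * P.Amax / P.N := by have := P.Ω_facts.2.2.2; positivity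
    have h1 := (Nat.ceil_lt_add_one h0).le
    have h2 : 2 * P.Amax / P.N ≤ 2 * P.Ω := by
      rw [div_le_iff₀ hN0]; nlinarith
    linarith
  -- `Ŝ ≤ ŜK + N ≤ n + 24 + K + N` and `N ≤ 3ⁿ Ω`
  have hSd : (P.Sd : ℝ) ≤ n + 24 + K n + P.N := by
    have h1 := P.Sd_le_SdK_add_N.2
    have h2 : SdK n ≤ n + 24 + K n := by
      unfold SdK
      have := Nat.log_le_self 2 (K n)  -- `Nat.log 2 K ≤ K`
      omega
    have : P.Sd ≤ n + 24 + K n + P.N := by omega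
    exact_mod_cast this
  have hN3 : (P.N : ℝ) ≤ 3 ^ n * P.Ω := by
    have h := P.hNΩ
    have hl : Real.log 2 > 0.6931471803 := Real.log_two_gt_d9
    have h3 : (2 : ℝ) / Real.log 2 ≤ 3 := by rw [div_le_iff₀ (by linarith)]; linarith
    have h4 : ((2 : ℝ) / Real.log 2) ^ n ≤ 3 ^ n := pow_le_pow_left₀ (by positivity) h3 n
    calc (P.N : ℝ) ≤ (2 / Real.log 2) ^ n * ∏ j, P.A j := h
      _ ≤ 3 ^ n * P.Ω := mul_le_mul_of_nonneg_right h4 hΩ0.le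
  have hLr : (P.L : ℝ) ≤ (⌈24 * Cb ^ n * P.Ω * K n * yloadK n * P.W / (G n * P.WN)⌉₊ : ℝ) + 2 ^ (n + 25) +
      ((⌈2 * P.Amax / P.N⌉₊ : ℝ) + 1) + 4 * ((P.Sd : ℝ) + 2) := by exact_mod_cast hLnat
  have h3n : (1 : ℝ) ≤ 3 ^ n := one_le_pow₀ (by norm_num)
  have hn0 : (0 : ℝ) ≤ n := Nat.cast_nonneg n
  -- everything not already `·Ω` is multiplied by `Ω ≥ 1`
  have e : (24 * Cb ^ n * K n * yloadK n / G n + 2 ^ (n + 25) + 4 * K n + 4 * 3 ^ n + 4 * n + 110) * P.Ω =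
      24 * Cb ^ n * K n * yloadK n / G n * P.Ω + 2 ^ (n + 25) * P.Ω + 4 * ((K n : ℝ) * P.Ω) +
        4 * (3 ^ n * P.Ω) + 4 * ((n : ℝ) * P.Ω) + 110 * P.Ω := by ring
  have h1 : (2 : ℝ) ^ (n + 25) ≤ 2 ^ (n + 25) * P.Ω := le_mul_of_one_le_right (by positivity) hΩ1
  have h2 : (K n : ℝ) ≤ (K n : ℝ) * P.Ω := le_mul_of_one_le_right hK.le hΩ1
  have h3 : (n : ℝ) ≤ (n : ℝ) * P.Ω := le_mul_of_one_le_right hn0 hΩ1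
  rw [e]
  linarith

/-- **Exit B for `ArchG3Rec`** (`n ≥ 2`), modulo the two numeric side conditions on
`c_L = 24C_bⁿK·yload_K/G + 2^{n+25} + 4K + 4·3ⁿ + 4n + 110` (sequel `ArchG3RecEndNum`):
clause (B) of `RecordArchW` in `exitB_of_bounds` shape. [cite: Nesterenko2003, §5.2 Lemma 5.4] -/
theorem exitB (hn2 : 2 ≤ n)
    (hN0 : (((n + 1).factorial : ℕ) : ℝ) * ((n.factorial : ℕ) : ℝ) * 2 ^ (n - 1) * ((n : ℝ) + 2) ^ (4 * n) *
        (24 * Cb ^ n * K n * yloadK n / G n + 2 ^ (n + 25) + 4 * K n + 4 * 3 ^ n + 4 * n + 110) ≤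
      (16 * ((n : ℝ) + 1)) ^ n * 2 ^ ((n + 22) * n) * 2 ^ (n + 23))
    (hN1 : (((n + 1).factorial : ℕ) : ℝ) * (((n - 1).factorial : ℕ) : ℝ) * 2 ^ n * ((n : ℝ) + 2) ^ (4 * (n - 1)) *
        (24 * Cb ^ n * K n * yloadK n / G n + 2 ^ (n + 25) + 4 * K n + 4 * 3 ^ n + 4 * n + 110) ≤
      (16 * ((n : ℝ) + 1)) ^ (n - 1) * 2 ^ ((n + 22) * (n - 1)) * 2 ^ (n + 22) * 2 ^ (n + 23)) :
    ∀ d₀ : ℕ, d₀ ≤ 1 →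
      (n + 1).factorial * 2 ^ n * P.D₀ * ∏ j, P.D j <
        Nat.choose (P.S₀ + (n - d₀)) (n - d₀) * (2 * P.Xfin + 1) * (d₀.factorial * P.D₀ ^ d₀) := by
  obtain ⟨hD, hρ1, hρ⟩ := P.rho_facts
  obtain ⟨hL1, hL0, h25, -⟩ := P.L_real
  have hA1 : ∀ j, 1 ≤ P.A j := fun j => (P.A_facts j).2.1
  have hX1 : (1 : ℝ) ≤ P.X := by linarith [P.X_floors.2.1]
  have hD₀half : (P.D₀ : ℝ) ≤ (P.X : ℝ) * P.L / 2 := by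
    have h := P.D₀_bounds.2
    have hXL : (16 : ℝ) ≤ (P.X : ℝ) * P.L := by nlinarith [P.X_floors.2.1]
    linarith
  have hs : (16 : ℝ) * (n + 1) * P.L ≤ ((P.S₀ : ℝ) + 1) * ((n : ℝ) + 2) ^ 4 := by
    have h := P.M_lt_S₀_succ_mul
    have h' : ((16 * (n + 1) * P.L : ℕ) : ℝ) < (((P.S₀ + 1) * (n + 2) ^ 4 : ℕ) : ℝ) := by exact_mod_cast h
    push_cast at h'; linarith
  exact RecordExitsNumeric.exitB_capped (by omega) hA1 hD (by linarith) hρ hL0 hX1 P.end_floors.1 hD₀half hs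
    (P.Xfin_sharp hn2) P.L_le_mul_Omega hN0 hN1

end ArchG3Rec

end Summit.ABC.StewartYu
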